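import Literature.Computability.Complexity.AutomaticSequencesProofs
import Literature.Computability.Complexity.AutomaticSequencesCoonsProofs
import Summits.QuantumAdvantage.QuantumAdvantage.Theses.MobiusLadder

/-!
# Route `MobiusLadder`, item `LiouvilleLangNotRegular` (stmt-QuantumAdvantage-1399)

The automatic rung of route `QuantumAdvantage/MobiusLadder`: the language
`L = {bin(N) : λ(N) = -1}` of canonical least-significant-bit-first binary numerals
(Mathlib `Computability.encodingNatBool`) of the integers with `λ(N) = -1` (`Ω(N)` odd) is NOT a
regular language (M. Coons, J. Théor. Nombres Bordeaux 22 (2010), Cor. 1.7: `Ω mod 2` is not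
`2`-automatic; Allouche–Shallit 2003, Lemma 5.2.6 / Thm 6.6.2: automatic ⟺ regular fibres).

## Proof (assembly of PROVED tree facts)

* `Literature.Computability.Complexity.allouche_shallit_twoKernel_finite_iff_fibres_regular_holds`
  (proved, `AutomaticSequencesProofs.lean`): a sequence over a finite alphabet has finite
  `2`-kernel iff every fibre language `{encodeNat n : a n = d}` is regular;
* `Literature.Computability.Complexity.coons_cardFactors_mod_two_not_automatic_holds` (proved,
  `AutomaticSequencesCoonsProofs.lean`): `n ↦ Ω n % 2` has infinite `2`-kernel.

Glue proved here: with the Boolean sequence `a n := [λ n = -1]`, the fibre `true` is `L` itself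
and the fibre `false` (numerals of `{0} ∪ {n ≥ 1 : λ n = 1}`) is `{ε} ∪ L.leftQuotient [false]`,
because `λ(2n) = -λ(n)` and `encodeNat (2n) = false :: encodeNat n` for `n ≥ 1`; both are regular
when `L` is (Myhill–Nerode, Mathlib `Language.isRegular_iff_finite_range_leftQuotient`). Hence
`a` has finite `2`-kernel, and so does its pointwise image `Ω n % 2 = (if a n then 1 else 0)`
(Coons's Lemma 1.6), contradicting Corollary 1.7. The two numeral identities used
(`encodeNat 0 = ε`, `encodeNat (2n) = false :: encodeNat n`) are proved inline from Mathlib's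
`Num.ofNat'_bit` (they exist in the tree only inside unrelated stack-machine files).
-/

set_option linter.dupNamespace false -- D-0017: single-problem summit ⇒ `QuantumAdvantage.QuantumAdvantage` by design

namespace Summit.QuantumAdvantage.QuantumAdvantage.Theorems.MobiusLadder

open _root_.Computability Literature.Computability.Complexity

/-- A left quotient of a regular language is regular (its left quotients are among those of the
language, `Language.leftQuotient_append`; Myhill–Nerode). [folklore] -/
theorem isRegular_leftQuotient {L : Language Bool} (h : L.IsRegular) (x : List Bool) :
    (L.leftQuotient x).IsRegular := by
  apply Language.IsRegular.of_finite_range_leftQuotient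
  refine h.finite_range_leftQuotient.subset ?_
  rintro _ ⟨y, rfl⟩
  exact ⟨x ++ y, Language.leftQuotient_append L x y⟩

/-- The language `{ε}` is regular (its left quotients are `{ε}` and `∅`; Myhill–Nerode).
[folklore] -/
theorem isRegular_one : (1 : Language Bool).IsRegular := by
  apply Language.IsRegular.of_finite_range_leftQuotient
  refine ((Set.finite_singleton (0 : Language Bool)).insert 1).subset ?_
  rintro _ ⟨x, rfl⟩
  rcases x with _ | ⟨b, x⟩
  · exact Or.inl (Language.leftQuotient_nil _)
  · refine Or.inr ?_
    rw [Set.mem_singleton_iff]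
    ext y
    simp [Language.mem_one]

/-- For `n ≠ 0`, `λ n ≠ -1 ↔ λ n = 1` (`λ n = (-1)^{Ω n}`). [folklore] -/
theorem liouville_ne_neg_one_iff {n : ℕ} (hn : n ≠ 0) :
    ArithmeticFunction.liouville n ≠ -1 ↔ ArithmeticFunction.liouville n = 1 := by
  rw [ArithmeticFunction.liouville_apply hn]
  rcases neg_one_pow_eq_or ℤ (ArithmeticFunction.cardFactors n) with h | h <;> rw [h] <;> norm_num

/-- The fibre `false` of `n ↦ [λ n = -1]`: the numerals of `{n : λ n ≠ -1}` form the language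
`{ε} ∪ L.leftQuotient [false]`, `L` the numerals of `{n : λ n = -1}` (since `λ 0 = 0`,
`λ(2n) = λ(2) λ(n) = -λ(n)` and `encodeNat (2n) = false :: encodeNat n` for `n ≥ 1`, the latter
from Mathlib's `Num.ofNat'_bit`). [folklore] -/
theorem toLanguage_liouville_ne_eq :
    encodingNatBool.toLanguage {n : ℕ | ArithmeticFunction.liouville n ≠ -1} =
      1 + (encodingNatBool.toLanguage {N : ℕ | ArithmeticFunction.liouville N = -1}).leftQuotient
        [false] := by
  -- numeral identities: `encodeNat 0 = ε` and `encodeNat (2n) = false :: encodeNat n` (`n ≠ 0`)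
  have h0 : encodeNat 0 = [] := by decide
  have hbit : ∀ n : ℕ, n ≠ 0 → encodeNat (2 * n) = false :: encodeNat n := by
    intro n hn
    have h2 : 2 * n = Nat.bit false n := by rw [Nat.bit_val]; simp
    have hcast : ((Nat.bit false n : ℕ) : Num) = cond false Num.bit1 Num.bit0 (n : Num) := by
      rw [← Num.ofNat'_eq, Num.ofNat'_bit, Num.ofNat'_eq]
    rw [h2]
    unfold encodeNat
    rw [hcast]
    cases hm : (n : Num) with
    | zero =>
      exfalso
      apply hn
      rw [← @Num.of_nat_inj n 0, hm, Nat.cast_zero]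
      rfl
    | pos p => rfl
  -- `λ(2n) = -λ(n)`
  have hl2 : ∀ n : ℕ, ArithmeticFunction.liouville (2 * n) = -ArithmeticFunction.liouville n := by
    intro n
    rw [ArithmeticFunction.liouville_apply_mul,
      ArithmeticFunction.liouville_apply (by norm_num : (2 : ℕ) ≠ 0),
      ArithmeticFunction.cardFactors_apply_prime Nat.prime_two]
    ring
  ext w
  rw [Language.mem_add, Language.mem_one, Language.mem_leftQuotient]
  constructor
  · rintro ⟨n, hn, rfl⟩
    change ArithmeticFunction.liouville n ≠ -1 at hn
    rcases eq_or_ne n 0 with rfl | hn0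
    · exact Or.inl h0
    · refine Or.inr ⟨2 * n, ?_, ?_⟩
      · change ArithmeticFunction.liouville (2 * n) = -1
        rw [hl2, (liouville_ne_neg_one_iff hn0).mp hn]
      · change encodeNat (2 * n) = [false] ++ encodeNat n
        rw [hbit n hn0, List.singleton_append]
  · rintro (rfl | ⟨m, hm, hmw⟩)
    · refine ⟨0, ?_, h0⟩
      change ArithmeticFunction.liouville 0 ≠ -1
      simp
    · change ArithmeticFunction.liouville m = -1 at hm
      change encodeNat m = [false] ++ w at hmw
      rw [List.singleton_append] at hmw
      have hm0 : m ≠ 0 := by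
        rintro rfl
        simp at hm
      -- `m = 2 [w]` by reading off the value of the numeral
      have hval : m = 2 * bitsToNat w := by
        have h := bitsToNat_encodeNat m
        rw [hmw, bitsToNat_cons] at h
        simpa using h.symm
      have hn0 : bitsToNat w ≠ 0 := by
        intro h
        rw [h, mul_zero] at hval
        exact hm0 hval
      refine ⟨bitsToNat w, ?_, ?_⟩
      · change ArithmeticFunction.liouville (bitsToNat w) ≠ -1
        rw [hval, hl2] at hm
        rw [liouville_ne_neg_one_iff hn0]
        linear_combination -hm
      · change encodeNat (bitsToNat w) = w
        have h := hbit (bitsToNat w) hn0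
        rw [← hval, hmw] at h
        exact (List.cons.inj h).2.symm

/-- Settles `stmt-QuantumAdvantage-1399` (route MobiusLadder, support `LiouvilleLangNotRegular`):
the language of canonical LSB-first binary numerals of `{N : λ N = -1}` is not regular.
Proof: if it were, both fibres of the Boolean sequence `a n := [λ n = -1]` would be regular
(`toLanguage_liouville_ne_eq`, closure of regular languages under union and left quotients), so
`a` would have finite `2`-kernel (Allouche–Shallit, Lemma 5.2.6 / Thm 6.6.2, proved tree fact
`allouche_shallit_twoKernel_finite_iff_fibres_regular_holds`), hence so would its pointwise
image `n ↦ Ω n % 2 = (if a n then 1 else 0)` (Coons's Lemma 1.6: the kernel of `Φ ∘ a` is the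
image of the kernel of `a`), contradicting Coons 2010, Cor. 1.7 (proved tree fact
`coons_cardFactors_mod_two_not_automatic_holds`).
[cite: Coons2011, Corollary 1.7] [cite: AlloucheShallit2003, Lemma 5.2.6 and Theorem 6.6.2] -/
theorem LiouvilleLangNotRegular_proof :
    Summit.QuantumAdvantage.QuantumAdvantage.Theses.MobiusLadder.LiouvilleLangNotRegular := by
  unfold Summit.QuantumAdvantage.QuantumAdvantage.Theses.MobiusLadder.LiouvilleLangNotRegular
  intro hreg
  let a : ℕ → Bool := fun n => decide (ArithmeticFunction.liouville n = -1)
  have htrue : {n : ℕ | a n = true} = {N : ℕ | ArithmeticFunction.liouville N = -1} := by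
    ext n; simp [a]
  have hfalse : {n : ℕ | a n = false} = {n : ℕ | ArithmeticFunction.liouville n ≠ -1} := by
    ext n; simp [a]
  -- finite `2`-kernel of `a` (Allouche–Shallit: both fibres are regular)
  have hK : IsKAutomatic 2 a := by
    refine (allouche_shallit_twoKernel_finite_iff_fibres_regular_holds Bool a).mpr ?_
    intro d
    cases d with
    | false =>
      rw [hfalse, toLanguage_liouville_ne_eq]
      exact isRegular_one.add (isRegular_leftQuotient hreg [false])
    | true =>
      rw [htrue]
      exact hreg
  -- `Ω mod 2` is the pointwise image of `a`
  have hΩ : (fun n => ArithmeticFunction.cardFactors n % 2) =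
      (fun b : Bool => if b then 1 else 0) ∘ a := by
    funext n
    simp only [Function.comp_apply, a]
    rcases eq_or_ne n 0 with rfl | hn
    · simp
    · rw [ArithmeticFunction.liouville_apply hn]
      rcases Nat.even_or_odd (ArithmeticFunction.cardFactors n) with he | ho
      · rw [he.neg_one_pow, Nat.even_iff.mp he]
        norm_num
      · rw [ho.neg_one_pow, Nat.odd_iff.mp ho]
        norm_num
  -- Coons's Lemma 1.6: the kernel of `Φ ∘ a` is the image of the kernel of `a`, hence finite
  have hΩK : IsKAutomatic 2 (fun n => ArithmeticFunction.cardFactors n % 2) := by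
    rw [hΩ]
    unfold IsKAutomatic at hK ⊢
    refine (hK.image fun u => (fun b : Bool => if b then 1 else 0) ∘ u).subset ?_
    rintro u ⟨l, r, hr, rfl⟩
    exact ⟨fun n => a (2 ^ l * n + r), ⟨l, r, hr, rfl⟩, rfl⟩
  exact coons_cardFactors_mod_two_not_automatic_holds hΩK

end Summit.QuantumAdvantage.QuantumAdvantage.Theorems.MobiusLadder
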